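import Summits.Ventures.PercRepro.GZSwap

/-!
# C-026 at the class level: the cut tree `δ`, the pairing, and the residual `Bot₃` (p5, gen 7)

mine-3's `proofs/MINE3-Q3-gzpass.md` §1 reduces the class lemma of C-026 (`P(a~b)·P(c iso) ≤
P(exactly one pair)`, the Harris-matching upper bound) on the full cube of a marked multigraph to
`#{S : a ~_S b ∧ c iso in S̄} ≤ #{S : exactly one pair}` and pairs the left side, Gladkov–Zimin style,
through the **cut tree** `δ(S) = S Δ (E[M] ∪ (E[L] ∖ E[K]))` (`K, L, M` = the open clusters of `a, b, c`
in `S`; the class-level restriction of p5's `swapSetC`, GZ24's `S₁`):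

* `IsCIso ω a b c` — `c ≁ a ∧ c ≁ b` (the rows `ab|c`, `a|b|c`); **`cutSwap`** — `δ`;
  `cutSwap_eq_mix` / `compl_cutSwap_eq_mix` — `(δ(S), δ(S)ᶜ)` is the static swap of the antipodal pair
  `(S, S̄)` along `swapSetC`, hence **`cutSwap_injective`** / **`cutSwap_bijective`** (from
  `recoverable_swapSetC`, `SwapSets.lean`);
* the cut property **`cluster_compl_cutSwap_c`**: `M` is sealed in the partner `δ(S)ᶜ`, so
  `isCIso_compl_cutSwap_iff`;
* **`Bad3`** — `c iso in S ∧ a ~ b in δ(S)`; **THE PAIRING `card_conn_cIso_compl_eq_card_bad3`**: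
  `#{S : a ~_S b ∧ c iso in S̄} = #{S : Bad₃ S}`;
* the split **`bad3_iff_or`**: `Bad₃ = ab|c ⊔ Bot₃` with **`Bot3`** = `bot ∧ a ~ b in δ(S)` (every
  `ab|c` configuration is bad: `conn_cutSwap_of_conn_of_not_conn`), the cells of `OnePair`
  (`card_onePair_eq_add`), and the reduction **`card_bad3_le_iff`**: the class lemma
  `#Bad₃ ≤ #OnePair` is exactly `#Bot₃ ≤ #(ac|b) + #(bc|a)` — the form the pass scheme
  (`C026Pass.lean`) attacks.  The link to `kernel26` / `cubeSumQuad` is `C026Class.lean`.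
-/

namespace PercRepro

namespace MultiGraph

section CutTree

variable {V E : Type*} (G : MultiGraph V E)

/-- `c` is isolated from the marks `a` and `b`: `c ≁ a ∧ c ≁ b` (the rows `ab|c` and `a|b|c`; the
decreasing event of C-026). -/
def IsCIso (ω : Config E) (a b c : V) : Prop := ¬ G.Conn ω a c ∧ ¬ G.Conn ω b c

open Classical in
/-- **The cut tree** `δ(S) = S Δ (E[M] ∪ (E[L] ∖ E[K]))` (`K, L, M` the clusters of `a, b, c` in `S`):
explore `Com_c` with the second copy, then `Com_a` with the first, then `Com_b` with the second, the
rest with the first — at the class level, every edge of `swapSetC S a b c` is flipped. -/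
noncomputable def cutSwap (a b c : V) (ω : Config E) : Config E :=
  fun e => if e ∈ G.swapSetC ω a b c then !ω e else ω e

/-- The cut tree flips the edges of `swapSetC`. -/
theorem cutSwap_apply_of_mem {a b c : V} {ω : Config E} {e : E} (he : e ∈ G.swapSetC ω a b c) :
    G.cutSwap a b c ω e = !ω e := by
  simp [cutSwap, he]

/-- The cut tree keeps the other edges. -/
theorem cutSwap_apply_of_notMem {a b c : V} {ω : Config E} {e : E}
    (he : e ∉ G.swapSetC ω a b c) : G.cutSwap a b c ω e = ω e := by
  simp [cutSwap, he]

/-- `δ(S)` is the first swapped configuration of the antipodal pair `(S, S̄)` along `swapSetC`. -/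
theorem cutSwap_eq_mix (a b c : V) (ω : Config E) :
    G.cutSwap a b c ω = mix (G.swapSetC ω a b c)ᶜ ω ωᶜ := by
  funext e
  by_cases he : e ∈ G.swapSetC ω a b c
  · rw [G.cutSwap_apply_of_mem he, mix_compl_apply_of_mem he, compl_apply_not]
  · rw [G.cutSwap_apply_of_notMem he, mix_compl_apply_of_notMem he]

/-- `δ(S)ᶜ` is the second swapped configuration of the antipodal pair `(S, S̄)` along `swapSetC`. -/
theorem compl_cutSwap_eq_mix (a b c : V) (ω : Config E) :
    (G.cutSwap a b c ω)ᶜ = mix (G.swapSetC ω a b c) ω ωᶜ := by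
  funext e
  rw [compl_apply_not]
  by_cases he : e ∈ G.swapSetC ω a b c
  · rw [G.cutSwap_apply_of_mem he, mix_apply_of_mem he, Bool.not_not]
  · rw [G.cutSwap_apply_of_notMem he, mix_apply_of_notMem he, compl_apply_not]

/-- **The cut tree is injective**: `(δ(S), δ(S)ᶜ)` is the recoverable swap of `(S, S̄)`. -/
theorem cutSwap_injective (a b c : V) : Function.Injective (G.cutSwap a b c) := by
  intro ω ω' h
  have hpair : swapPair (fun ω _ => G.swapSetC ω a b c) (ω, ωᶜ) =
      swapPair (fun ω _ => G.swapSetC ω a b c) (ω', ω'ᶜ) := by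
    simp only [swapPair]
    rw [← G.cutSwap_eq_mix, ← G.compl_cutSwap_eq_mix, ← G.cutSwap_eq_mix,
      ← G.compl_cutSwap_eq_mix, h]
  have := swapPair_injective (recoverable_swapSetC (G := G) a b c) hpair
  exact congrArg Prod.fst this

/-- **The cut property**: `M = Com_c(S)` is sealed in the partner `δ(S)ᶜ` (on `E[M]` the partner agrees
with `S`, and `M` has a closed boundary in `S`). -/
theorem cluster_compl_cutSwap_c (a b c : V) (ω : Config E) :
    G.cluster (G.cutSwap a b c ω)ᶜ c = G.cluster ω c := by
  refine cluster_eq_of_agree fun e he => ?_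
  have hmem : e ∈ G.swapSetC ω a b c := Or.inl he
  rw [compl_apply_not, G.cutSwap_apply_of_mem hmem, Bool.not_not]

/-- Connections of `c` in the partner `δ(S)ᶜ` are those of `S`. -/
theorem conn_compl_cutSwap_c_iff (a b c v : V) (ω : Config E) :
    G.Conn (G.cutSwap a b c ω)ᶜ c v ↔ G.Conn ω c v := by
  rw [← mem_cluster, ← mem_cluster, G.cluster_compl_cutSwap_c]

/-- `c` is isolated in the partner `δ(S)ᶜ` iff it is isolated in `S`. -/
theorem isCIso_compl_cutSwap_iff (a b c : V) (ω : Config E) :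
    G.IsCIso (G.cutSwap a b c ω)ᶜ a b c ↔ G.IsCIso ω a b c := by
  unfold IsCIso
  rw [G.conn_comm (u := a), G.conn_comm (u := b), G.conn_compl_cutSwap_c_iff,
    G.conn_compl_cutSwap_c_iff, G.conn_comm (u := c) (v := a), G.conn_comm (u := c) (v := b)]

/-- **The bad configurations of C-026** (mine-3's `Bad₃`): `c` isolated in `S`, and `a ~ b` in `δ(S)`. -/
def Bad3 (ω : Config E) (a b c : V) : Prop := G.IsCIso ω a b c ∧ G.Conn (G.cutSwap a b c ω) a b

/-- **The residual** `Bot₃`: all three marks separate in `S`, and `a ~ b` in `δ(S)`. -/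
def Bot3 (ω : Config E) (a b c : V) : Prop := G.IsBot ω a b c ∧ G.Conn (G.cutSwap a b c ω) a b

/-- An `ω`-open edge at the cluster of `a` is not flipped by the cut tree when `a ≁ c`
(it lies inside `K`, away from `M`). -/
theorem not_mem_swapSetC_of_open_edgesAt {a b c : V} {ω : Config E} (hac : ¬ G.Conn ω a c) {e : E}
    (he : ω e = true) (hK : e ∈ G.edgesAt (G.cluster ω a)) : e ∉ G.swapSetC ω a b c := by
  intro hmem
  rcases hmem with hM | ⟨_, hK'⟩
  · -- both endpoints are in `K`; one is in `M`: `K` meets `M`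
    have hfst : G.fst e ∈ G.cluster ω a := by
      rcases hK with h | h
      · exact h
      · exact G.fst_mem_cluster_of_open he h
    have hsnd : G.snd e ∈ G.cluster ω a := by
      rcases hK with h | h
      · exact G.snd_mem_cluster_of_open he h
      · exact h
    rcases hM with h | h
    · exact hac (G.mem_cluster_of_mem_inter hfst h)
    · exact hac (G.mem_cluster_of_mem_inter hsnd h)
  · exact hK' hK

/-- **Every `ab|c` configuration is bad**: with `a ~_S b` and `a ≁_S c`, the cluster `K = L` is untouched
by the cut tree, so `a ~ b` in `δ(S)`. -/
theorem conn_cutSwap_of_conn_of_not_conn {a b c : V} {ω : Config E} (hab : G.Conn ω a b)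
    (hac : ¬ G.Conn ω a c) : G.Conn (G.cutSwap a b c ω) a b :=
  conn_of_open_edges (fun e he hK => by
    rw [G.cutSwap_apply_of_notMem (G.not_mem_swapSetC_of_open_edgesAt hac he hK)]
    exact he) hab

/-- **The split `Bad₃ = ab|c ⊔ Bot₃`.** -/
theorem bad3_iff_or (a b c : V) (ω : Config E) :
    G.Bad3 ω a b c ↔ (G.Conn ω a b ∧ ¬ G.Conn ω a c) ∨ G.Bot3 ω a b c := by
  constructor
  · rintro ⟨⟨hac, hbc⟩, hδ⟩
    by_cases hab : G.Conn ω a b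
    · exact Or.inl ⟨hab, hac⟩
    · exact Or.inr ⟨⟨hab, hac, hbc⟩, hδ⟩
  · rintro (⟨hab, hac⟩ | ⟨⟨_, hac, hbc⟩, hδ⟩)
    · exact ⟨⟨hac, fun hbc => hac (hab.trans hbc)⟩, G.conn_cutSwap_of_conn_of_not_conn hab hac⟩
    · exact ⟨⟨hac, hbc⟩, hδ⟩

variable [Fintype E]

/-- **The cut tree is a bijection** of the finite cube. -/
theorem cutSwap_bijective (a b c : V) : Function.Bijective (G.cutSwap a b c) :=
  Finite.injective_iff_bijective.mp (G.cutSwap_injective a b c)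

variable [DecidableEq E]

open Classical in
/-- **THE PAIRING** (mine-3 §1, Theorem 8.1 for the cut tree):
`#{S : a ~_S b ∧ c iso in S̄} = #{S : Bad₃ S}` — the map `S ↦ δ(S)` sends `Bad₃` onto the left side. -/
theorem card_conn_cIso_compl_eq_card_bad3 (a b c : V) :
    (Finset.univ.filter fun ω : Config E => G.Conn ω a b ∧ G.IsCIso ωᶜ a b c).card =
      (Finset.univ.filter fun ω : Config E => G.Bad3 ω a b c).card := by
  let e : Config E ≃ Config E := Equiv.ofBijective (G.cutSwap a b c) (G.cutSwap_bijective a b c)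
  symm
  refine Finset.card_nbij' (fun ω => e ω) (fun τ => e.symm τ) ?_ ?_ ?_ ?_
  · intro ω hω
    simp only [Finset.coe_filter, Finset.mem_univ, true_and, Set.mem_setOf_eq] at hω ⊢
    show G.Conn (G.cutSwap a b c ω) a b ∧ G.IsCIso (G.cutSwap a b c ω)ᶜ a b c
    exact ⟨hω.2, (G.isCIso_compl_cutSwap_iff a b c ω).mpr hω.1⟩
  · intro τ hτ
    simp only [Finset.coe_filter, Finset.mem_univ, true_and, Set.mem_setOf_eq] at hτ ⊢
    have hτ' : G.cutSwap a b c (e.symm τ) = τ := e.apply_symm_apply τ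
    constructor
    · rw [← G.isCIso_compl_cutSwap_iff, hτ']
      exact hτ.2
    · rw [hτ']
      exact hτ.1
  · intro ω _
    exact e.symm_apply_apply ω
  · intro τ _
    exact e.apply_symm_apply τ

open Classical in
/-- `#Bad₃ = #(ab|c) + #Bot₃`. -/
theorem card_bad3_eq_add (a b c : V) :
    (Finset.univ.filter fun ω : Config E => G.Bad3 ω a b c).card =
      (Finset.univ.filter fun ω : Config E => G.Conn ω a b ∧ ¬ G.Conn ω a c).card +
        (Finset.univ.filter fun ω : Config E => G.Bot3 ω a b c).card := by
  rw [← Finset.card_union_of_disjoint]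
  · congr 1
    ext ω
    simp only [Finset.mem_filter, Finset.mem_univ, true_and, Finset.mem_union]
    exact G.bad3_iff_or a b c ω
  · rw [Finset.disjoint_left]
    intro ω h1 h2
    simp only [Finset.mem_filter, Finset.mem_univ, true_and] at h1 h2
    exact h2.1.1 h1.1

open Classical in
/-- `#OnePair = #(ab|c) + #(ac|b) + #(bc|a)`. -/
theorem card_onePair_eq_add (a b c : V) :
    (Finset.univ.filter fun ω : Config E => G.OnePair ω a b c).card =
      (Finset.univ.filter fun ω : Config E => G.Conn ω a b ∧ ¬ G.Conn ω a c).card +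
        (Finset.univ.filter fun ω : Config E => G.Conn ω a c ∧ ¬ G.Conn ω a b).card +
          (Finset.univ.filter fun ω : Config E => G.Conn ω b c ∧ ¬ G.Conn ω a b).card := by
  rw [← Finset.card_union_of_disjoint, ← Finset.card_union_of_disjoint]
  · congr 1
    ext ω
    simp only [Finset.mem_filter, Finset.mem_univ, true_and, Finset.mem_union, OnePair]
    tauto
  · rw [Finset.disjoint_left]
    intro ω h1 h2
    simp only [Finset.mem_filter, Finset.mem_univ, true_and, Finset.mem_union] at h1 h2
    rcases h1 with h1 | h1
    · exact h2.2 h1.1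
    · exact h2.2 (h1.1.trans h2.1.symm)
  · rw [Finset.disjoint_left]
    intro ω h1 h2
    simp only [Finset.mem_filter, Finset.mem_univ, true_and] at h1 h2
    exact h2.2 h1.1

open Classical in
/-- **The reduction**: the class lemma `#Bad₃ ≤ #OnePair` is exactly `#Bot₃ ≤ #(ac|b) + #(bc|a)`. -/
theorem card_bad3_le_iff (a b c : V) :
    (Finset.univ.filter fun ω : Config E => G.Bad3 ω a b c).card ≤
        (Finset.univ.filter fun ω : Config E => G.OnePair ω a b c).card ↔
      (Finset.univ.filter fun ω : Config E => G.Bot3 ω a b c).card ≤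
        (Finset.univ.filter fun ω : Config E => G.Conn ω a c ∧ ¬ G.Conn ω a b).card +
          (Finset.univ.filter fun ω : Config E => G.Conn ω b c ∧ ¬ G.Conn ω a b).card := by
  rw [G.card_bad3_eq_add, G.card_onePair_eq_add]
  omega

end CutTree

end MultiGraph

end PercRepro
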